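import Literature.Analysis.FluidPDE.CKNLocalEnergyEstimate
import Literature.Analysis.FluidPDE.CKNInterpolationEstimate
import Literature.Analysis.FunctionSpaces.SobolevBallScaling
import Literature.Analysis.FluidPDE.PressureSliceDecay
import HarnessLib

/-!
# Seregin's decay form of the multiplicative inequality:
# `C(r) ≤ c [(r/ϱ)³ A(ϱ)^{3/2} + (ϱ/r)³ A(ϱ)^{3/4} E(ϱ)^{3/4}]` (Seregin 2014, Lemma 6.2)

Analysis/FluidPDE proof file (everything proved; no definitions, no named facts), fourth file of
the bottom-up discharge of
`Literature.Analysis.FluidPDE.Seregin2020_axisymmetricSingularPoint_typeII` (G. Seregin,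
Anal. Math. Phys. 10 (2020) = arXiv:2006.04140, Thm. 2.1), serving the case `limsup E < ∞` of
the remark following Def. 1.7 ("`g(z₀) < ∞ ⇒ G(z₀) < ∞`", after Seregin 2006). In that case the
energy `A` may be large while `E ≤ M`, and the functional of the iteration is `A^{3/2}`; the cubic
quantity must then be estimated by the TWO-RADII form of the multiplicative inequality,

> **Lemma 6.2** (Seregin 2014, (6.1.34)). For all `0 < r ≤ ϱ ≤ 1`,
> `C(r) ≤ c [(r/ϱ)³ A^{3/2}(ϱ) + (ϱ/r)³ A^{3/4}(ϱ) E^{3/4}(ϱ)]`,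

whose point is the small factor `(r/ϱ)³` in front of the superlinear term `A^{3/2}`. The printed
proof: `∫_{B(r)} |v|² ≤ ∫_{B(ϱ)} ||v|² - [|v|²]_ϱ| + (r/ϱ)³ ∫_{B(ϱ)} |v|² ≤ cϱ ∫_{B(ϱ)} |∇v||v|
+ (r/ϱ)³ ∫_{B(ϱ)} |v|²` (6.1.35) by the Poincaré–Sobolev inequality for `|v|²`, then the
multiplicative inequality `∫_{B(r)} |v|³ ≤ c[(∫_{B(r)}|∇v|²)^{3/4} (∫_{B(r)}|v|²)^{3/4}
+ r^{-3/2} (∫_{B(r)}|v|²)^{3/2}]`, and integration in time with Hölder's inequality.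

This file proves it in the accepted vocabulary (`cknAEss`, `cknE`, `cknC` on backward parabolic
balls), for all `0 < r ≤ ϱ` (no restriction `ϱ ≤ 1`, the statement being scale invariant), from
the tree's scale-invariant ball inequalities `FunctionSpaces.exists_eLpNorm_le_ball`
(Sobolev `W^{1,2}(B_r) ⊂ L⁶(B_r)`) and `FunctionSpaces.exists_eLpNorm_sub_average_le_ball`
(Poincaré–Sobolev `W^{1,1} ⊂ L^{3/2}` for mean-zero functions), the product rule for `|v|²`
(`FunctionSpaces.memSobolevDomain_one_one_norm_sq`, `HasWeakFDerivOn.norm_sq`), the Lebesgue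
interpolation `lintegral_pow_three_le_Lp_interpolation`, `rpow_threeHalves_add_le_two_mul`
(`PressureSliceDecay.lean`) and the slicing of weak spatial
gradients (`HasWeakSpatialGradientOn.ae_hasWeakFDerivOn_ball`), following the printed proof:

* `exists_slice_cubic_decay` — the slice estimate on `B_κ ⊆ B₁`:
  `∫_{B_κ}|v|³ ≤ K[κ³(∫_{B₁}|v|²)^{3/2} + κ^{-3/2}(∫_{B₁}|v|²)^{3/4}(∫_{B₁}|∇v|²)^{3/4}]`;
* `exists_cknC_le_decay_unit` — integration in time over `]-κ², 0[`: the case `ϱ = 1`;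
* `exists_cknC_le_decay` — every `0 < r ≤ ϱ` and centre, by the Navier–Stokes scaling.

## References

* G. Seregin, *Lecture Notes on Regularity Theory for the Navier–Stokes Equations*, World
  Scientific (2014), Lemma 6.2, (6.1.34)–(6.1.35). [`Seregin2014`]
* G. Seregin, Anal. Math. Phys. 10 (2020), Paper 46: remark after Def. 1.7. [`Seregin2020`]
* L. C. Evans, *Partial Differential Equations* (2010), §5.6.1, §5.8.1. [`Evans2010`]
-/

noncomputable section

open MeasureTheory Set Function Filter Topology TopologicalSpace Metric Module
open scoped NNReal ENNReal

namespace Literature.Analysis.FluidPDE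

namespace Seregin2020

/-! ### Elementary tools -/

/-- `X⁻¹^{3/2} (X³)^{3/2} = X³` for `0 < X < ∞` in `ℝ≥0∞`. [folklore] -/
theorem inv_rpow_mul_cube_rpow {X : ℝ≥0∞} (h0 : X ≠ 0) (htop : X ≠ ∞) :
    X⁻¹ ^ (3 / 2 : ℝ) * (X ^ 3) ^ (3 / 2 : ℝ) = X ^ 3 := by
  rw [ENNReal.inv_rpow, ← ENNReal.rpow_neg,
    show (X ^ 3 : ℝ≥0∞) = X ^ (3 : ℝ) by rw [← ENNReal.rpow_natCast]; norm_num,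
    ← ENNReal.rpow_mul, ← ENNReal.rpow_add _ _ h0 htop]
  norm_num

/-- `1 ≤ X⁻¹^{3/2}` for `X ≤ 1`. [folklore] -/
theorem one_le_inv_rpow {X : ℝ≥0∞} (h : X ≤ 1) : 1 ≤ X⁻¹ ^ (3 / 2 : ℝ) := by
  have : 1 ≤ X⁻¹ := ENNReal.one_le_inv.2 h
  calc (1 : ℝ≥0∞) = 1 ^ (3 / 2 : ℝ) := (ENNReal.one_rpow _).symm
    _ ≤ X⁻¹ ^ (3 / 2 : ℝ) := ENNReal.rpow_le_rpow this (by norm_num)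

/-- **The slice estimate behind Seregin's Lemma 6.2** (Seregin 2014, proof of Lemma 6.2,
(6.1.35) and the display following it, at unit outer radius): there is an absolute `K` such
that for every `v ∈ L²(B₁; ℝ³)` with weak derivative `Gv` on the unit ball, `|Gv| ∈ L²`, and
every `0 < κ ≤ 1`,
`∫_{B_κ} |v|³ ≤ K [κ³ (∫_{B₁}|v|²)^{3/2} + κ^{-3/2} (∫_{B₁}|v|²)^{3/4} (∫_{B₁}|Gv|²)^{3/4}]`
(multiplicative inequality on `B_κ`, and
`∫_{B_κ}|v|² ≤ ∫_{B₁}||v|² - (|v|²)_{B₁}| + κ³∫_{B₁}|v|² ≤ c(∫|v|²)^{1/2}(∫|Gv|²)^{1/2} + κ³∫|v|²`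
by the Sobolev–Poincaré inequality for `|v|²`). [cite: Seregin2014, proof of Lemma 6.2 (6.1.35)] -/
theorem exists_slice_cubic_decay :
    ∃ K : ℝ≥0, ∀ (v : EuclideanSpace ℝ (Fin 3) → EuclideanSpace ℝ (Fin 3))
      (Gv : EuclideanSpace ℝ (Fin 3) → EuclideanSpace ℝ (Fin 3) →L[ℝ] EuclideanSpace ℝ (Fin 3))
      (κ : ℝ), 0 < κ → κ ≤ 1 →
      FunctionSpaces.HasWeakFDerivOn
        (⟨ball (0 : EuclideanSpace ℝ (Fin 3)) 1, isOpen_ball⟩ : Opens (EuclideanSpace ℝ (Fin 3)))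
        volume v Gv →
      (∫⁻ x in ball (0 : EuclideanSpace ℝ (Fin 3)) 1, ‖v x‖ₑ ^ 2) ≠ ∞ →
      (∫⁻ x in ball (0 : EuclideanSpace ℝ (Fin 3)) 1, ENNReal.ofReal (frobeniusNormSq (Gv x))) ≠ ∞ →
      ∫⁻ x in ball (0 : EuclideanSpace ℝ (Fin 3)) κ, ‖v x‖ₑ ^ (3 : ℕ) ≤
        K * (ENNReal.ofReal κ ^ 3 * (∫⁻ x in ball (0 : EuclideanSpace ℝ (Fin 3)) 1, ‖v x‖ₑ ^ 2) ^ (3 / 2 : ℝ) +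
          (ENNReal.ofReal κ)⁻¹ ^ (3 / 2 : ℝ) *
            (∫⁻ x in ball (0 : EuclideanSpace ℝ (Fin 3)) 1, ‖v x‖ₑ ^ 2) ^ (3 / 4 : ℝ) *
            (∫⁻ x in ball (0 : EuclideanSpace ℝ (Fin 3)) 1,
              ENNReal.ofReal (frobeniusNormSq (Gv x))) ^ (3 / 4 : ℝ)) := by
  -- the two ball inequalities with scale-invariant constants
  obtain ⟨CS, hCS⟩ := FunctionSpaces.exists_eLpNorm_le_ball (E := EuclideanSpace ℝ (Fin 3))
    (F := EuclideanSpace ℝ (Fin 3)) (p := 2) (p' := 6) one_le_two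
    (by rw [finrank_euclideanSpace_fin]; norm_num) (by rw [finrank_euclideanSpace_fin]; norm_num)
  obtain ⟨CSP, hCSP⟩ := FunctionSpaces.exists_eLpNorm_sub_average_le_ball
    (E := EuclideanSpace ℝ (Fin 3)) (F := ℝ) (p := 1) (p' := 3 / 2) le_rfl
    (by rw [finrank_euclideanSpace_fin]; norm_num) (by rw [finrank_euclideanSpace_fin]; norm_num)
  set V : ℝ≥0∞ := volume (ball (0 : EuclideanSpace ℝ (Fin 3)) 1) with hV
  have hV0 : V ≠ 0 := (measure_ball_pos volume _ one_pos).ne'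
  have hVtop : V ≠ ∞ := measure_ball_lt_top.ne
  -- constants
  set c₁ : ℝ≥0∞ := 2 * (CS : ℝ≥0∞) ^ (3 / 2 : ℝ) with hc₁
  set c₂ : ℝ≥0∞ := 2 * CSP * V ^ (1 / 3 : ℝ) with hc₂
  set K : ℝ≥0∞ := c₁ * 2 * (c₂ ^ (3 / 2 : ℝ) + 1) with hK
  have hc₁top : c₁ ≠ ∞ := ENNReal.mul_ne_top ENNReal.ofNat_ne_top
    (ENNReal.rpow_ne_top_of_nonneg (by norm_num) ENNReal.coe_ne_top)
  have hc₂top : c₂ ≠ ∞ := ENNReal.mul_ne_top (ENNReal.mul_ne_top ENNReal.ofNat_ne_top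
    ENNReal.coe_ne_top) (ENNReal.rpow_ne_top_of_nonneg (by norm_num) hVtop)
  have hKtop : K ≠ ∞ := ENNReal.mul_ne_top (ENNReal.mul_ne_top hc₁top ENNReal.ofNat_ne_top)
    (ENNReal.add_ne_top.2 ⟨ENNReal.rpow_ne_top_of_nonneg (by norm_num) hc₂top, ENNReal.one_ne_top⟩)
  refine ⟨K.toNNReal, fun v Gv κ hκ hκ1 hw ha he => ?_⟩
  rw [ENNReal.coe_toNNReal hKtop]
  -- notation
  set B₁ : Set (EuclideanSpace ℝ (Fin 3)) := ball 0 1 with hB₁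
  set Bκ : Set (EuclideanSpace ℝ (Fin 3)) := ball 0 κ with hBκ
  set a : ℝ≥0∞ := ∫⁻ x in B₁, ‖v x‖ₑ ^ 2 with hadef
  set e : ℝ≥0∞ := ∫⁻ x in B₁, ENNReal.ofReal (frobeniusNormSq (Gv x)) with hedef
  set aκ : ℝ≥0∞ := ∫⁻ x in Bκ, ‖v x‖ₑ ^ 2 with haκ
  have hsub : Bκ ⊆ B₁ := ball_subset_ball hκ1
  have hle : (⟨Bκ, isOpen_ball⟩ : Opens (EuclideanSpace ℝ (Fin 3))) ≤ ⟨B₁, isOpen_ball⟩ := hsub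
  have hX0 : ENNReal.ofReal κ ≠ 0 := (ENNReal.ofReal_pos.2 hκ).ne'
  have hXtop : ENNReal.ofReal κ ≠ ∞ := ENNReal.ofReal_ne_top
  have hX1 : ENNReal.ofReal κ ≤ 1 := by rw [← ENNReal.ofReal_one]; exact ENNReal.ofReal_le_ofReal hκ1
  -- measurability
  have hvm : AEStronglyMeasurable v (volume.restrict B₁) := hw.locallyIntegrableOn.aestronglyMeasurable
  have hGm : AEStronglyMeasurable Gv (volume.restrict B₁) := hw.locallyIntegrableOn_deriv.aestronglyMeasurable
  have hwκ : FunctionSpaces.HasWeakFDerivOn (⟨Bκ, isOpen_ball⟩ : Opens (EuclideanSpace ℝ (Fin 3)))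
      volume v Gv := FunctionSpaces.HasWeakFDerivOn.mono_set_holds hw hle
  have hvmκ : AEStronglyMeasurable v (volume.restrict Bκ) := hwκ.locallyIntegrableOn.aestronglyMeasurable
  have hGmκ : AEStronglyMeasurable Gv (volume.restrict Bκ) := hwκ.locallyIntegrableOn_deriv.aestronglyMeasurable
  -- `L²` norms as powers of `a`, `aκ`, `e`
  have hL2 : ∀ (ν : Measure (EuclideanSpace ℝ (Fin 3))),
      eLpNorm v 2 ν = (∫⁻ x, ‖v x‖ₑ ^ 2 ∂ν) ^ (1 / 2 : ℝ) := fun ν => by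
    rw [eLpNorm_eq_lintegral_rpow_enorm_toReal two_ne_zero ENNReal.ofNat_ne_top,
      ENNReal.toReal_ofNat]
    simp only [one_div]
    congr 1
    refine lintegral_congr fun x => ?_
    rw [show (2 : ℝ) = ((2 : ℕ) : ℝ) by norm_num, ENNReal.rpow_natCast]
  have ha1 : eLpNorm v 2 (volume.restrict B₁) = a ^ (1 / 2 : ℝ) := hL2 (volume.restrict B₁)
  have haκ1 : eLpNorm v 2 (volume.restrict Bκ) = aκ ^ (1 / 2 : ℝ) := hL2 (volume.restrict Bκ)
  have haκa : aκ ≤ a := lintegral_mono_set hsub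
  have haκtop : aκ ≠ ∞ := ne_top_of_le_ne_top ha haκa
  have he1 : eLpNorm Gv 2 (volume.restrict B₁) ≤ e ^ (1 / 2 : ℝ) :=
    eLpNorm_two_le_lintegral_frobeniusNormSq_rpow (volume.restrict B₁) Gv
  have heκ : eLpNorm Gv 2 (volume.restrict Bκ) ≤ e ^ (1 / 2 : ℝ) :=
    (eLpNorm_mono_measure Gv (Measure.restrict_mono hsub le_rfl)).trans he1
  have hetop' : e ^ (1 / 2 : ℝ) ≠ ∞ := ENNReal.rpow_ne_top_of_nonneg (by norm_num) he
  -- Sobolev classes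
  have hv2 : MemLp v 2 (volume.restrict B₁) := ⟨hvm, by rw [ha1]; exact ENNReal.rpow_lt_top_of_nonneg (by norm_num) ha⟩
  have hG2 : MemLp Gv 2 (volume.restrict B₁) := ⟨hGm, lt_of_le_of_lt he1 (lt_top_iff_ne_top.2 hetop')⟩
  have hv2κ : MemLp v 2 (volume.restrict Bκ) := hv2.mono_measure (Measure.restrict_mono hsub le_rfl)
  have hG2κ : MemLp Gv 2 (volume.restrict Bκ) := hG2.mono_measure (Measure.restrict_mono hsub le_rfl)
  have hsob : ∀ {B : Set (EuclideanSpace ℝ (Fin 3))} (hB : IsOpen B),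
      FunctionSpaces.HasWeakFDerivOn (⟨B, hB⟩ : Opens (EuclideanSpace ℝ (Fin 3))) volume v Gv →
      MemLp v 2 (volume.restrict B) → MemLp Gv 2 (volume.restrict B) →
      FunctionSpaces.MemSobolevDomain 1 ((2 : ℝ≥0) : ℝ≥0∞)
        (⟨B, hB⟩ : Opens (EuclideanSpace ℝ (Fin 3))) volume v := by
    intro B hB hwB hvB hGB
    refine FunctionSpaces.memSobolevDomain_succ_iff.2 ⟨by exact_mod_cast hvB, Gv, hwB, fun w => ?_⟩
    rw [FunctionSpaces.memSobolevDomain_zero_iff]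
    exact_mod_cast (ContinuousLinearMap.apply ℝ (EuclideanSpace ℝ (Fin 3)) w).comp_memLp' hGB
  have hsob₁ := hsob isOpen_ball hw hv2 hG2
  have hsobκ := hsob isOpen_ball hwκ hv2κ hG2κ
  -- ### (1) the multiplicative inequality on `B_κ`
  have hS : eLpNorm v 6 (volume.restrict Bκ) ≤ CS * ((ENNReal.ofReal κ)⁻¹ * aκ ^ (1 / 2 : ℝ) + e ^ (1 / 2 : ℝ)) := by
    have := hCS 0 κ hκ v Gv (by exact_mod_cast hsobκ) hwκ
    push_cast at this
    rw [haκ1] at this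
    refine this.trans ?_
    gcongr
  have hL6 : (∫⁻ x in Bκ, ‖v x‖ₑ ^ (6 : ℝ)) ^ (1 / 4 : ℝ) = eLpNorm v 6 (volume.restrict Bκ) ^ (3 / 2 : ℝ) := by
    rw [eLpNorm_eq_lintegral_rpow_enorm_toReal (by norm_num) ENNReal.ofNat_ne_top,
      ENNReal.toReal_ofNat, ← ENNReal.rpow_mul]
    norm_num
  have hH := lintegral_pow_three_le_Lp_interpolation (volume.restrict Bκ) hvmκ.enorm
  have step1 : ∫⁻ x in Bκ, ‖v x‖ₑ ^ (3 : ℕ) ≤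
      c₁ * ((ENNReal.ofReal κ)⁻¹ ^ (3 / 2 : ℝ) * aκ ^ (3 / 2 : ℝ) + aκ ^ (3 / 4 : ℝ) * e ^ (3 / 4 : ℝ)) := by
    calc ∫⁻ x in Bκ, ‖v x‖ₑ ^ (3 : ℕ)
        ≤ aκ ^ (3 / 4 : ℝ) * (∫⁻ x in Bκ, ‖v x‖ₑ ^ (6 : ℝ)) ^ (1 / 4 : ℝ) := hH
      _ = aκ ^ (3 / 4 : ℝ) * eLpNorm v 6 (volume.restrict Bκ) ^ (3 / 2 : ℝ) := by rw [hL6]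
      _ ≤ aκ ^ (3 / 4 : ℝ) *
          ((CS : ℝ≥0∞) * ((ENNReal.ofReal κ)⁻¹ * aκ ^ (1 / 2 : ℝ) + e ^ (1 / 2 : ℝ))) ^ (3 / 2 : ℝ) := by
          gcongr
      _ = aκ ^ (3 / 4 : ℝ) * ((CS : ℝ≥0∞) ^ (3 / 2 : ℝ) *
          ((ENNReal.ofReal κ)⁻¹ * aκ ^ (1 / 2 : ℝ) + e ^ (1 / 2 : ℝ)) ^ (3 / 2 : ℝ)) := by
          rw [ENNReal.mul_rpow_of_nonneg (CS : ℝ≥0∞)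
            ((ENNReal.ofReal κ)⁻¹ * aκ ^ (1 / 2 : ℝ) + e ^ (1 / 2 : ℝ)) (by norm_num)]
      _ ≤ aκ ^ (3 / 4 : ℝ) * ((CS : ℝ≥0∞) ^ (3 / 2 : ℝ) *
          (2 * (((ENNReal.ofReal κ)⁻¹ * aκ ^ (1 / 2 : ℝ)) ^ (3 / 2 : ℝ) +
            (e ^ (1 / 2 : ℝ)) ^ (3 / 2 : ℝ)))) := by
          gcongr
          exact rpow_threeHalves_add_le_two_mul _ _
      _ = aκ ^ (3 / 4 : ℝ) * ((CS : ℝ≥0∞) ^ (3 / 2 : ℝ) *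
          (2 * ((ENNReal.ofReal κ)⁻¹ ^ (3 / 2 : ℝ) * aκ ^ (3 / 4 : ℝ) + e ^ (3 / 4 : ℝ)))) := by
          rw [ENNReal.mul_rpow_of_nonneg ((ENNReal.ofReal κ)⁻¹) (aκ ^ (1 / 2 : ℝ)) (by norm_num),
            ← ENNReal.rpow_mul aκ, ← ENNReal.rpow_mul e]
          norm_num
      _ = c₁ * ((ENNReal.ofReal κ)⁻¹ ^ (3 / 2 : ℝ) * (aκ ^ (3 / 4 : ℝ) * aκ ^ (3 / 4 : ℝ)) +
          aκ ^ (3 / 4 : ℝ) * e ^ (3 / 4 : ℝ)) := by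
          rw [hc₁]; ring
      _ = c₁ * ((ENNReal.ofReal κ)⁻¹ ^ (3 / 2 : ℝ) * aκ ^ (3 / 2 : ℝ) +
          aκ ^ (3 / 4 : ℝ) * e ^ (3 / 4 : ℝ)) := by
          rw [← ENNReal.rpow_add_of_nonneg _ _ (by norm_num) (by norm_num)]
          norm_num
  -- ### (2) `aκ ≤ c₂ a^{1/2} e^{1/2} + κ³ a` (Seregin 2014, (6.1.35))
  set g : EuclideanSpace ℝ (Fin 3) → ℝ := fun x => ‖v x‖ ^ 2 with hg
  set α : ℝ := ⨍ y in B₁, g y with hα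
  set Dg : EuclideanSpace ℝ (Fin 3) → EuclideanSpace ℝ (Fin 3) →L[ℝ] ℝ :=
    fun x => (2 : ℝ) • (innerSL ℝ (v x)).comp (Gv x) with hDg
  have hBL : FunctionSpaces.IsLipschitzDomain
      (⟨B₁, isOpen_ball⟩ : Opens (EuclideanSpace ℝ (Fin 3))) :=
    FunctionSpaces.isLipschitzDomain_ball (0 : EuclideanSpace ℝ (Fin 3)) 1
  have hBb : Bornology.IsBounded
      ((⟨B₁, isOpen_ball⟩ : Opens (EuclideanSpace ℝ (Fin 3))) : Set (EuclideanSpace ℝ (Fin 3))) :=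
    isBounded_ball
  have hg1 : FunctionSpaces.MemSobolevDomain 1 1
      (⟨B₁, isOpen_ball⟩ : Opens (EuclideanSpace ℝ (Fin 3))) volume g :=
    FunctionSpaces.memSobolevDomain_one_one_norm_sq hBL hBb hsob₁ hw
  have hDgw : FunctionSpaces.HasWeakFDerivOn
      (⟨B₁, isOpen_ball⟩ : Opens (EuclideanSpace ℝ (Fin 3))) volume g Dg := hw.norm_sq hBL hBb hsob₁
  have hSP : eLpNorm (fun x => g x - α) (3 / 2 : ℝ≥0∞) (volume.restrict B₁) ≤ c₂ * V⁻¹ ^ (1 / 3 : ℝ) * 0 +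
      2 * CSP * (a ^ (1 / 2 : ℝ) * e ^ (1 / 2 : ℝ)) := by
    have h1 := hCSP 0 1 one_pos g Dg (by exact_mod_cast hg1) hDgw
    have hD1 : eLpNorm Dg 1 (volume.restrict B₁) ≤ 2 * eLpNorm v 2 (volume.restrict B₁) * eLpNorm Gv 2 (volume.restrict B₁) :=
      FunctionSpaces.eLpNorm_two_smul_innerSL_comp_le hvm hGm
    have e32 : ((3 / 2 : ℝ≥0) : ℝ≥0∞) = (3 / 2 : ℝ≥0∞) := by norm_num
    rw [e32] at h1
    rw [mul_zero, zero_add]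
    calc eLpNorm (fun x => g x - α) (3 / 2 : ℝ≥0∞) (volume.restrict B₁) ≤ CSP * eLpNorm Dg 1 (volume.restrict B₁) := h1
      _ ≤ CSP * (2 * eLpNorm v 2 (volume.restrict B₁) * eLpNorm Gv 2 (volume.restrict B₁)) := by gcongr
      _ ≤ CSP * (2 * a ^ (1 / 2 : ℝ) * e ^ (1 / 2 : ℝ)) := by rw [ha1]; gcongr
      _ = 2 * CSP * (a ^ (1 / 2 : ℝ) * e ^ (1 / 2 : ℝ)) := by ring
  -- Hölder `L^{3/2} · L³` against `1` on `B₁`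
  have hgm : AEMeasurable (fun x => g x - α) (volume.restrict B₁) := (hvm.norm.aemeasurable.pow_const 2).sub_const α
  have hT : ∫⁻ x in B₁, ‖g x - α‖ₑ ≤ c₂ * (a ^ (1 / 2 : ℝ) * e ^ (1 / 2 : ℝ)) := by
    have hH1 := lintegral_mul_le_threeHalves_three (volume.restrict B₁) (a := fun x => ‖g x - α‖ₑ) (b := fun _ => 1)
      hgm.enorm aemeasurable_const
    have h32 : (∫⁻ x, ‖g x - α‖ₑ ^ (3 / 2 : ℝ) ∂(volume.restrict B₁)) ^ (2 / 3 : ℝ) =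
        eLpNorm (fun x => g x - α) (3 / 2 : ℝ≥0∞) (volume.restrict B₁) := by
      rw [eLpNorm_eq_lintegral_rpow_enorm_toReal (by norm_num)
        (ENNReal.div_ne_top (by norm_num) (by norm_num)), ENNReal.toReal_div]
      norm_num
    simp only [mul_one, one_pow, lintegral_const, one_mul] at hH1
    rw [h32, Measure.restrict_apply_univ] at hH1
    calc ∫⁻ x in B₁, ‖g x - α‖ₑ ≤ eLpNorm (fun x => g x - α) (3 / 2 : ℝ≥0∞) (volume.restrict B₁) * V ^ (1 / 3 : ℝ) := hH1
      _ ≤ (2 * CSP * (a ^ (1 / 2 : ℝ) * e ^ (1 / 2 : ℝ))) * V ^ (1 / 3 : ℝ) := by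
          gcongr; simpa using hSP
      _ = c₂ * (a ^ (1 / 2 : ℝ) * e ^ (1 / 2 : ℝ)) := by rw [hc₂]; ring
  -- the mean term: `‖α‖ₑ |B_κ| = κ³ a`
  have hαeq : ‖α‖ₑ * volume Bκ = ENNReal.ofReal κ ^ 3 * a := by
    have hg_int : ∫ x in B₁, g x = a.toReal := by
      rw [integral_eq_lintegral_of_nonneg_ae (Eventually.of_forall fun x => by positivity)
        (hvm.norm.aemeasurable.pow_const 2).aestronglyMeasurable]
      congr 1
      refine lintegral_congr fun x => ?_
      show ENNReal.ofReal (‖v x‖ ^ 2) = ‖v x‖ₑ ^ 2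
      rw [ENNReal.ofReal_pow (norm_nonneg _), ofReal_norm]
    have hα' : α = (V.toReal)⁻¹ * a.toReal := by
      rw [hα, setAverage_eq, hg_int, smul_eq_mul, measureReal_def]
    have hα0 : 0 ≤ α := by rw [hα']; positivity
    have hαe : ‖α‖ₑ = a / V := by
      rw [Real.enorm_eq_ofReal hα0, hα', ← div_eq_inv_mul, ENNReal.ofReal_div_of_pos,
        ENNReal.ofReal_toReal ha, ENNReal.ofReal_toReal hVtop]
      exact ENNReal.toReal_pos hV0 hVtop
    have hvolκ : volume Bκ = ENNReal.ofReal κ ^ 3 * V := by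
      rw [hBκ, Measure.addHaar_ball_of_pos volume (0 : EuclideanSpace ℝ (Fin 3)) hκ,
        finrank_euclideanSpace_fin, ENNReal.ofReal_pow hκ.le]
    rw [hαe, hvolκ]
    calc a / V * (ENNReal.ofReal κ ^ 3 * V) = ENNReal.ofReal κ ^ 3 * (a / V * V) := by ring
      _ = ENNReal.ofReal κ ^ 3 * a := by rw [ENNReal.div_mul_cancel hV0 hVtop]
  have step2 : aκ ≤ c₂ * (a ^ (1 / 2 : ℝ) * e ^ (1 / 2 : ℝ)) + ENNReal.ofReal κ ^ 3 * a := by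
    have hpt : ∀ x, ‖v x‖ₑ ^ 2 ≤ ‖g x - α‖ₑ + ‖α‖ₑ := fun x => by
      have e1 : ‖v x‖ₑ ^ 2 = ‖g x‖ₑ := by
        show ‖v x‖ₑ ^ 2 = ‖‖v x‖ ^ 2‖ₑ
        rw [Real.enorm_eq_ofReal (by positivity), ENNReal.ofReal_pow (norm_nonneg _),
          ofReal_norm]
      rw [e1]
      calc ‖g x‖ₑ = ‖(g x - α) + α‖ₑ := by rw [sub_add_cancel]
        _ ≤ ‖g x - α‖ₑ + ‖α‖ₑ := enorm_add_le _ _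
    calc aκ ≤ ∫⁻ x in Bκ, (‖g x - α‖ₑ + ‖α‖ₑ) := lintegral_mono fun x => hpt x
      _ = (∫⁻ x in Bκ, ‖g x - α‖ₑ) + ‖α‖ₑ * volume Bκ := by
          rw [lintegral_add_right _ measurable_const, lintegral_const, Measure.restrict_apply_univ]
      _ ≤ (∫⁻ x in B₁, ‖g x - α‖ₑ) + ‖α‖ₑ * volume Bκ :=
          add_le_add (lintegral_mono_set hsub) le_rfl
      _ ≤ c₂ * (a ^ (1 / 2 : ℝ) * e ^ (1 / 2 : ℝ)) + ENNReal.ofReal κ ^ 3 * a := by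
          rw [hαeq]; gcongr
  -- ### (3) assemble
  have step3 : (ENNReal.ofReal κ)⁻¹ ^ (3 / 2 : ℝ) * aκ ^ (3 / 2 : ℝ) ≤
      2 * c₂ ^ (3 / 2 : ℝ) * ((ENNReal.ofReal κ)⁻¹ ^ (3 / 2 : ℝ) * a ^ (3 / 4 : ℝ) * e ^ (3 / 4 : ℝ)) +
        2 * (ENNReal.ofReal κ ^ 3 * a ^ (3 / 2 : ℝ)) := by
    have h1 : aκ ^ (3 / 2 : ℝ) ≤ 2 * ((c₂ * (a ^ (1 / 2 : ℝ) * e ^ (1 / 2 : ℝ))) ^ (3 / 2 : ℝ) +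
        (ENNReal.ofReal κ ^ 3 * a) ^ (3 / 2 : ℝ)) :=
      (ENNReal.rpow_le_rpow step2 (by norm_num)).trans (rpow_threeHalves_add_le_two_mul _ _)
    have e1 : (c₂ * (a ^ (1 / 2 : ℝ) * e ^ (1 / 2 : ℝ))) ^ (3 / 2 : ℝ) =
        c₂ ^ (3 / 2 : ℝ) * (a ^ (3 / 4 : ℝ) * e ^ (3 / 4 : ℝ)) := by
      rw [ENNReal.mul_rpow_of_nonneg c₂ (a ^ (1 / 2 : ℝ) * e ^ (1 / 2 : ℝ)) (by norm_num),
        ENNReal.mul_rpow_of_nonneg (a ^ (1 / 2 : ℝ)) (e ^ (1 / 2 : ℝ)) (by norm_num),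
        ← ENNReal.rpow_mul a, ← ENNReal.rpow_mul e]
      norm_num
    have e2 : (ENNReal.ofReal κ ^ 3 * a) ^ (3 / 2 : ℝ) =
        (ENNReal.ofReal κ ^ 3) ^ (3 / 2 : ℝ) * a ^ (3 / 2 : ℝ) :=
      ENNReal.mul_rpow_of_nonneg (ENNReal.ofReal κ ^ 3) a (by norm_num)
    rw [e1, e2] at h1
    calc (ENNReal.ofReal κ)⁻¹ ^ (3 / 2 : ℝ) * aκ ^ (3 / 2 : ℝ)
        ≤ (ENNReal.ofReal κ)⁻¹ ^ (3 / 2 : ℝ) * (2 * (c₂ ^ (3 / 2 : ℝ) * (a ^ (3 / 4 : ℝ) * e ^ (3 / 4 : ℝ)) +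
            (ENNReal.ofReal κ ^ 3) ^ (3 / 2 : ℝ) * a ^ (3 / 2 : ℝ))) := by gcongr
      _ = 2 * c₂ ^ (3 / 2 : ℝ) * ((ENNReal.ofReal κ)⁻¹ ^ (3 / 2 : ℝ) * a ^ (3 / 4 : ℝ) * e ^ (3 / 4 : ℝ)) +
          2 * (((ENNReal.ofReal κ)⁻¹ ^ (3 / 2 : ℝ) * (ENNReal.ofReal κ ^ 3) ^ (3 / 2 : ℝ)) *
            a ^ (3 / 2 : ℝ)) := by ring
      _ = _ := by rw [inv_rpow_mul_cube_rpow hX0 hXtop]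
  have step4 : aκ ^ (3 / 4 : ℝ) * e ^ (3 / 4 : ℝ) ≤
      (ENNReal.ofReal κ)⁻¹ ^ (3 / 2 : ℝ) * a ^ (3 / 4 : ℝ) * e ^ (3 / 4 : ℝ) := by
    calc aκ ^ (3 / 4 : ℝ) * e ^ (3 / 4 : ℝ) ≤ 1 * a ^ (3 / 4 : ℝ) * e ^ (3 / 4 : ℝ) := by
          rw [one_mul]; gcongr
      _ ≤ _ := by gcongr; exact one_le_inv_rpow hX1
  -- final
  set P : ℝ≥0∞ := ENNReal.ofReal κ ^ 3 * a ^ (3 / 2 : ℝ) with hP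
  set R : ℝ≥0∞ := (ENNReal.ofReal κ)⁻¹ ^ (3 / 2 : ℝ) * a ^ (3 / 4 : ℝ) * e ^ (3 / 4 : ℝ) with hR
  calc ∫⁻ x in Bκ, ‖v x‖ₑ ^ (3 : ℕ)
      ≤ c₁ * ((ENNReal.ofReal κ)⁻¹ ^ (3 / 2 : ℝ) * aκ ^ (3 / 2 : ℝ) + aκ ^ (3 / 4 : ℝ) * e ^ (3 / 4 : ℝ)) :=
        step1
    _ ≤ c₁ * ((2 * c₂ ^ (3 / 2 : ℝ) * R + 2 * P) + R) := by gcongr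
    _ = c₁ * 2 * P + c₁ * (2 * c₂ ^ (3 / 2 : ℝ) + 1) * R := by ring
    _ ≤ K * P + K * R := by
        gcongr
        · rw [hK]
          calc c₁ * 2 = c₁ * 2 * 1 := (mul_one _).symm
            _ ≤ c₁ * 2 * (c₂ ^ (3 / 2 : ℝ) + 1) := by gcongr; exact le_add_self
        · rw [hK]
          calc c₁ * (2 * c₂ ^ (3 / 2 : ℝ) + 1) ≤ c₁ * (2 * c₂ ^ (3 / 2 : ℝ) + 2 * 1) := by
                gcongr; norm_num
            _ = c₁ * 2 * (c₂ ^ (3 / 2 : ℝ) + 1) := by ring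
    _ = K * (P + R) := by ring

/-- Hölder against `1`: `∫ f^{3/4} ≤ (∫ f)^{3/4} (μ univ)^{1/4}`. [folklore] -/
theorem lintegral_rpow_three_quarters_le' {α : Type*} [MeasurableSpace α] (μ : Measure α)
    {f : α → ℝ≥0∞} (hf : AEMeasurable f μ) :
    ∫⁻ x, f x ^ (3 / 4 : ℝ) ∂μ ≤ (∫⁻ x, f x ∂μ) ^ (3 / 4 : ℝ) * (μ univ) ^ (1 / 4 : ℝ) := by
  have hpq : (4 / 3 : ℝ).HolderConjugate 4 := Real.holderConjugate_iff.2 ⟨by norm_num, by norm_num⟩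
  have key := ENNReal.lintegral_mul_le_Lp_mul_Lq μ hpq (hf.pow_const (3 / 4 : ℝ))
    (g := fun _ => 1) aemeasurable_const
  have h2 : ∀ x, (f x ^ (3 / 4 : ℝ)) ^ (4 / 3 : ℝ) = f x := fun x => by
    rw [← ENNReal.rpow_mul, show (3 / 4 : ℝ) * (4 / 3) = 1 by norm_num, ENNReal.rpow_one]
  simp only [Pi.mul_apply, mul_one, h2, ENNReal.one_rpow, lintegral_const, one_mul] at key
  rw [show (1 : ℝ) / (4 / 3) = 3 / 4 by norm_num] at key
  exact key

/-- Exponent bookkeeping: `(X²)⁻¹ (X⁻¹^{3/2} X^{1/2}) = X⁻¹³` for `0 < X < ∞`. [folklore] -/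
theorem sq_inv_mul_inv_rpow_mul_rpow {X : ℝ≥0∞} (h0 : X ≠ 0) (htop : X ≠ ∞) :
    (X ^ 2)⁻¹ * (X⁻¹ ^ (3 / 2 : ℝ) * X ^ (1 / 2 : ℝ)) = X⁻¹ ^ 3 := by
  have e1 : (X ^ 2)⁻¹ = X ^ (-2 : ℝ) := by
    rw [ENNReal.rpow_neg, show (2 : ℝ) = ((2 : ℕ) : ℝ) by norm_num, ENNReal.rpow_natCast]
  have e2 : X⁻¹ ^ (3 / 2 : ℝ) = X ^ (-(3 / 2) : ℝ) := by rw [ENNReal.inv_rpow, ENNReal.rpow_neg]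
  have e3 : X⁻¹ ^ 3 = X ^ (-3 : ℝ) := by
    rw [← ENNReal.inv_pow, ENNReal.rpow_neg, show (3 : ℝ) = ((3 : ℕ) : ℝ) by norm_num,
      ENNReal.rpow_natCast]
  rw [e1, e2, e3, ← ENNReal.rpow_add _ _ h0 htop, ← ENNReal.rpow_add _ _ h0 htop]
  norm_num

/-- `(X²)^{1/4} = X^{1/2}`. [folklore] -/
theorem sq_rpow_quarter (X : ℝ≥0∞) : (X ^ 2) ^ (1 / 4 : ℝ) = X ^ (1 / 2 : ℝ) := by
  rw [show (X ^ 2 : ℝ≥0∞) = X ^ (2 : ℝ) by rw [← ENNReal.rpow_natCast]; norm_num, ← ENNReal.rpow_mul]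
  norm_num

/-- **Seregin 2014, Lemma 6.2 at unit outer radius** ((6.1.34) with `ϱ = 1`): there is an
absolute `C₆` such that for every `u` with weak spatial gradient `G` on `Q₁(0)`, `A(1), E(1) < ∞`,
and every `0 < κ ≤ 1`,
`C(κ) ≤ C₆ [κ³ A(1)^{3/2} + κ⁻³ A(1)^{3/4} E(1)^{3/4}]` (`A = cknAEss`, `E = cknE`, `C = cknC`).
[cite: Seregin2014, Lemma 6.2 (6.1.34)] -/
theorem exists_cknC_le_decay_unit :
    ∃ C₆ : ℝ≥0, ∀ (u : ℝ → EuclideanSpace ℝ (Fin 3) → EuclideanSpace ℝ (Fin 3))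
      (G : ℝ → EuclideanSpace ℝ (Fin 3) → EuclideanSpace ℝ (Fin 3) →L[ℝ] EuclideanSpace ℝ (Fin 3))
      (κ : ℝ), 0 < κ → κ ≤ 1 →
      HasWeakSpatialGradientOn (parabolicCylinderOpens 1 0) u G →
      cknAEss 1 0 u ≠ ∞ → cknE 1 0 G ≠ ∞ →
      cknC κ 0 u ≤ C₆ * (ENNReal.ofReal κ ^ 3 * cknAEss 1 0 u ^ (3 / 2 : ℝ) +
        (ENNReal.ofReal κ)⁻¹ ^ 3 * cknAEss 1 0 u ^ (3 / 4 : ℝ) * cknE 1 0 G ^ (3 / 4 : ℝ)) := by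
  obtain ⟨K, hK⟩ := exists_slice_cubic_decay
  refine ⟨K, fun u G κ hκ hκ1 h hA hE => ?_⟩
  -- notation
  set B : Set (EuclideanSpace ℝ (Fin 3)) := ball 0 1 with hB
  set Bκ : Set (EuclideanSpace ℝ (Fin 3)) := ball 0 κ with hBκ
  set I : Set ℝ := Ioo (-1) 0 with hI
  set Iκ : Set ℝ := Ioo (-κ ^ 2) 0 with hIκ
  set X : ℝ≥0∞ := ENNReal.ofReal κ with hX
  have hX0 : X ≠ 0 := (ENNReal.ofReal_pos.2 hκ).ne'
  have hXtop : X ≠ ∞ := ENNReal.ofReal_ne_top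
  set a : ℝ → ℝ≥0∞ := fun t => ∫⁻ x in B, ‖u t x‖ₑ ^ 2 with ha
  set e : ℝ → ℝ≥0∞ := fun t => ∫⁻ x in B, ENNReal.ofReal (frobeniusNormSq (G t x)) with he
  set c : ℝ → ℝ≥0∞ := fun t => ∫⁻ x in Bκ, ‖u t x‖ₑ ^ (3 : ℕ) with hc
  have hQ : parabolicCylinder 1 (0 : ℝ × EuclideanSpace ℝ (Fin 3)) = I ×ˢ B := by
    simp [parabolicCylinder, hI, hB]
  have hQκ : parabolicCylinder κ (0 : ℝ × EuclideanSpace ℝ (Fin 3)) = Iκ ×ˢ Bκ := by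
    simp [parabolicCylinder, hIκ, hBκ]
  have hQI : Ioo ((0 : ℝ × EuclideanSpace ℝ (Fin 3)).1 - 1 ^ 2) (0 : ℝ × EuclideanSpace ℝ (Fin 3)).1 = I := by
    simp [hI]
  have hIκI : Iκ ⊆ I := by
    refine Ioo_subset_Ioo ?_ le_rfl
    have : κ ^ 2 ≤ 1 := pow_le_one₀ hκ.le hκ1
    linarith
  have hBκB : Bκ ⊆ B := ball_subset_ball hκ1
  have hsubκ : Iκ ×ˢ Bκ ⊆ I ×ˢ B := prod_mono hIκI hBκB
  -- the quantities at unit scale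
  set A := cknAEss 1 0 u with hAdef
  set EE := cknE 1 0 G with hEdef
  have hAeq : A = essSup a (volume.restrict I) := by
    simp only [hAdef, cknAEss, ENNReal.ofReal_one, inv_one, one_mul, hQI]
    rfl
  have hEeq : EE = ∫⁻ q in I ×ˢ B, ENNReal.ofReal (frobeniusNormSq (G q.1 q.2)) := by
    simp only [hEdef, cknE, ENNReal.ofReal_one, inv_one, one_mul, hQ]
  have hCeq : cknC κ 0 u = (X ^ 2)⁻¹ * ∫⁻ q in Iκ ×ˢ Bκ, ‖u q.1 q.2‖ₑ ^ (3 : ℕ) := by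
    simp only [cknC, hQκ, hX]
  -- measurability
  have hQsub : I ×ˢ B ⊆ ((parabolicCylinderOpens 1 (0 : ℝ × EuclideanSpace ℝ (Fin 3)) :
      Opens (ℝ × EuclideanSpace ℝ (Fin 3))) : Set (ℝ × EuclideanSpace ℝ (Fin 3))) := by
    rw [coe_parabolicCylinderOpens, hQ]
  have hum : AEStronglyMeasurable (uncurry u) (volume.restrict (Iκ ×ˢ Bκ)) :=
    (h.locallyIntegrableOn.mono_set (hsubκ.trans hQsub)).aestronglyMeasurable
  have hGm : AEStronglyMeasurable (uncurry G) (volume.restrict (I ×ˢ B)) :=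
    (h.locallyIntegrableOn_grad.mono_set hQsub).aestronglyMeasurable
  have hprod : (volume.restrict (I ×ˢ B) : Measure (ℝ × EuclideanSpace ℝ (Fin 3))) =
      (volume.restrict I).prod (volume.restrict B) := by
    rw [Measure.volume_eq_prod, Measure.prod_restrict]
  have hprodκ : (volume.restrict (Iκ ×ˢ Bκ) : Measure (ℝ × EuclideanSpace ℝ (Fin 3))) =
      (volume.restrict Iκ).prod (volume.restrict Bκ) := by
    rw [Measure.volume_eq_prod, Measure.prod_restrict]
  have hum3 : AEMeasurable (fun q : ℝ × EuclideanSpace ℝ (Fin 3) => ‖u q.1 q.2‖ₑ ^ (3 : ℕ))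
      ((volume.restrict Iκ).prod (volume.restrict Bκ)) := by
    rw [← hprodκ]; exact (hum.enorm.pow_const 3)
  have hGm2 : AEMeasurable (fun q : ℝ × EuclideanSpace ℝ (Fin 3) =>
      ENNReal.ofReal (frobeniusNormSq (G q.1 q.2))) ((volume.restrict I).prod (volume.restrict B)) := by
    rw [← hprod]
    exact (continuous_frobeniusNormSq'.comp_aestronglyMeasurable hGm).aemeasurable.ennreal_ofReal
  -- Tonelli
  have hEeq' : EE = ∫⁻ t in I, e t := by
    rw [hEeq, Measure.volume_eq_prod, setLIntegral_prod _ (by rwa [← Measure.prod_restrict])]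
  have hCeq' : ∫⁻ q in Iκ ×ˢ Bκ, ‖u q.1 q.2‖ₑ ^ (3 : ℕ) = ∫⁻ t in Iκ, c t := by
    rw [Measure.volume_eq_prod, setLIntegral_prod _ (by rwa [← Measure.prod_restrict])]
  have hem : AEMeasurable e (volume.restrict I) := hGm2.lintegral_prod_right'
  have hemκ : AEMeasurable e (volume.restrict Iκ) := hem.mono_measure (Measure.restrict_mono hIκI le_rfl)
  -- a.e. in time on `I`, then on `Iκ`
  have h1 : ∀ᵐ t ∂(volume.restrict I), a t ≤ A := by
    rw [hAeq]; exact ENNReal.ae_le_essSup a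
  have h2 : ∀ᵐ t ∂(volume.restrict I), e t < ∞ := by
    refine ae_lt_top' hem ?_
    rw [← hEeq']; exact hE
  have h3 : ∀ᵐ t ∂(volume.restrict I), FunctionSpaces.HasWeakFDerivOn
      (⟨B, isOpen_ball⟩ : Opens (EuclideanSpace ℝ (Fin 3))) volume (u t) (G t) := by
    have := h.ae_hasWeakFDerivOn_ball
    rwa [hQI] at this
  have hpt : ∀ᵐ t ∂(volume.restrict Iκ),
      c t ≤ K * (X ^ 3 * A ^ (3 / 2 : ℝ) + X⁻¹ ^ (3 / 2 : ℝ) * A ^ (3 / 4 : ℝ) * e t ^ (3 / 4 : ℝ)) := by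
    have h123 := ae_restrict_of_ae_restrict_of_subset hIκI (h1.and (h2.and h3))
    filter_upwards [h123] with t ht
    obtain ⟨hat, het, hwt⟩ := ht
    have hat' : a t ≠ ∞ := ne_top_of_le_ne_top hA hat
    have key := hK (u t) (G t) κ hκ hκ1 hwt hat' het.ne
    refine key.trans ?_
    gcongr
  -- integrate in time over `Iκ`
  have hvolIκ : (volume.restrict Iκ : Measure ℝ) univ = X ^ 2 := by
    rw [Measure.restrict_apply_univ, hIκ, Real.volume_Ioo, hX, ← ENNReal.ofReal_pow hκ.le]
    congr 1; ring
  have hKfin : (K : ℝ≥0∞) * (X⁻¹ ^ (3 / 2 : ℝ) * A ^ (3 / 4 : ℝ)) ≠ ∞ :=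
    ENNReal.mul_ne_top ENNReal.coe_ne_top (ENNReal.mul_ne_top
      (ENNReal.rpow_ne_top_of_nonneg (by norm_num) (ENNReal.inv_ne_top.2 hX0))
      (ENNReal.rpow_ne_top_of_nonneg (by norm_num) hA))
  have hint_e : ∫⁻ t in Iκ, e t ^ (3 / 4 : ℝ) ≤ EE ^ (3 / 4 : ℝ) * X ^ (1 / 2 : ℝ) := by
    calc ∫⁻ t in Iκ, e t ^ (3 / 4 : ℝ)
        ≤ (∫⁻ t in Iκ, e t) ^ (3 / 4 : ℝ) * ((volume.restrict Iκ) univ) ^ (1 / 4 : ℝ) :=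
          lintegral_rpow_three_quarters_le' _ hemκ
      _ ≤ (∫⁻ t in I, e t) ^ (3 / 4 : ℝ) * ((volume.restrict Iκ) univ) ^ (1 / 4 : ℝ) :=
          mul_le_mul_left (ENNReal.rpow_le_rpow (lintegral_mono_set hIκI) (by norm_num)) _
      _ = EE ^ (3 / 4 : ℝ) * X ^ (1 / 2 : ℝ) := by rw [← hEeq', hvolIκ, sq_rpow_quarter]
  have hint : ∫⁻ t in Iκ, c t ≤
      K * (X ^ 3 * A ^ (3 / 2 : ℝ)) * X ^ 2 + K * (X⁻¹ ^ (3 / 2 : ℝ) * A ^ (3 / 4 : ℝ)) *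
        (EE ^ (3 / 4 : ℝ) * X ^ (1 / 2 : ℝ)) := by
    calc ∫⁻ t in Iκ, c t
        ≤ ∫⁻ t in Iκ, (K * (X ^ 3 * A ^ (3 / 2 : ℝ)) +
            K * (X⁻¹ ^ (3 / 2 : ℝ) * A ^ (3 / 4 : ℝ)) * e t ^ (3 / 4 : ℝ)) := by
          refine lintegral_mono_ae (hpt.mono fun t ht => ht.trans_eq ?_)
          ring
      _ = K * (X ^ 3 * A ^ (3 / 2 : ℝ)) * (volume.restrict Iκ) univ +
          K * (X⁻¹ ^ (3 / 2 : ℝ) * A ^ (3 / 4 : ℝ)) * ∫⁻ t in Iκ, e t ^ (3 / 4 : ℝ) := by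
          rw [lintegral_add_left' aemeasurable_const, lintegral_const,
            lintegral_const_mul' _ _ hKfin]
      _ ≤ _ := by rw [hvolIκ]; gcongr
  -- conclude
  calc cknC κ 0 u = (X ^ 2)⁻¹ * ∫⁻ t in Iκ, c t := by rw [hCeq, hCeq']
    _ ≤ (X ^ 2)⁻¹ * (K * (X ^ 3 * A ^ (3 / 2 : ℝ)) * X ^ 2 +
        K * (X⁻¹ ^ (3 / 2 : ℝ) * A ^ (3 / 4 : ℝ)) * (EE ^ (3 / 4 : ℝ) * X ^ (1 / 2 : ℝ))) := by
        gcongr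
    _ = K * (((X ^ 2)⁻¹ * X ^ 2) * (X ^ 3 * A ^ (3 / 2 : ℝ))) +
        K * (((X ^ 2)⁻¹ * (X⁻¹ ^ (3 / 2 : ℝ) * X ^ (1 / 2 : ℝ))) * A ^ (3 / 4 : ℝ) * EE ^ (3 / 4 : ℝ)) := by
        ring
    _ = K * (X ^ 3 * A ^ (3 / 2 : ℝ)) + K * (X⁻¹ ^ 3 * A ^ (3 / 4 : ℝ) * EE ^ (3 / 4 : ℝ)) := by
        rw [ENNReal.inv_mul_cancel (pow_ne_zero 2 hX0) (ENNReal.pow_ne_top hXtop), one_mul,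
          sq_inv_mul_inv_rpow_mul_rpow hX0 hXtop]
    _ = _ := by ring

/-- **Seregin 2014, Lemma 6.2** ((6.1.34): "For all `0 < r ≤ ϱ ≤ 1`,
`C(r) ≤ c[(r/ϱ)³ A^{3/2}(ϱ) + (ϱ/r)³ A^{3/4}(ϱ) E^{3/4}(ϱ)]`", a scaled version of the
multiplicative inequality), in the accepted vocabulary and for all `0 < r ≤ ϱ`: for `u` with weak
spatial gradient `G` on `Q_ϱ(z)` and `A(ϱ), E(ϱ)` finite,
`C(r; z) ≤ C₆ [(r/ϱ)³ A(ϱ; z)^{3/2} + (ϱ/r)³ A(ϱ; z)^{3/4} E(ϱ; z)^{3/4}]`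
(`A = cknAEss`, `E = cknE`, `C = cknC`). From the unit case by the Navier–Stokes scaling.
[cite: Seregin2014, Lemma 6.2 (6.1.34)] -/
theorem exists_cknC_le_decay :
    ∃ C₆ : ℝ≥0, ∀ (u : ℝ → EuclideanSpace ℝ (Fin 3) → EuclideanSpace ℝ (Fin 3))
      (G : ℝ → EuclideanSpace ℝ (Fin 3) → EuclideanSpace ℝ (Fin 3) →L[ℝ] EuclideanSpace ℝ (Fin 3))
      (z : ℝ × EuclideanSpace ℝ (Fin 3)) (ϱ r : ℝ), 0 < r → r ≤ ϱ →
      HasWeakSpatialGradientOn (parabolicCylinderOpens ϱ z) u G →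
      cknAEss ϱ z u ≠ ∞ → cknE ϱ z G ≠ ∞ →
      cknC r z u ≤ C₆ * (ENNReal.ofReal (r / ϱ) ^ 3 * cknAEss ϱ z u ^ (3 / 2 : ℝ) +
        ENNReal.ofReal (ϱ / r) ^ 3 * cknAEss ϱ z u ^ (3 / 4 : ℝ) * cknE ϱ z G ^ (3 / 4 : ℝ)) := by
  obtain ⟨C₆, hC₆⟩ := exists_cknC_le_decay_unit
  refine ⟨C₆, fun u G z ϱ r hr hrϱ h hA hE => ?_⟩
  have hϱ : 0 < ϱ := lt_of_lt_of_le hr hrϱ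
  have hϱ2 : 0 < ϱ ^ 2 := by positivity
  set κ := r / ϱ with hκdef
  have hκ : 0 < κ := div_pos hr hϱ
  have hκ1 : κ ≤ 1 := (div_le_one hϱ).2 hrϱ
  -- the rescaled pair on `Q₁(0)`
  have hz : stAffine (ϱ ^ 2) ϱ z.1 z.2 (0 : ℝ × EuclideanSpace ℝ (Fin 3)) = z :=
    Prod.ext (by simp [stAffine]) (by simp [stAffine])
  have hC : cknC κ 0 (ϱ • stPull (ϱ ^ 2) ϱ z.1 z.2 u) = cknC r z u := by
    have := cknC_nsZoom hϱ hκ z.1 z.2 0 u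
    rw [hz] at this
    rw [this, hκdef, show ϱ * (r / ϱ) = r by field_simp]
  have hAe : cknAEss 1 0 (ϱ • stPull (ϱ ^ 2) ϱ z.1 z.2 u) = cknAEss ϱ z u := by
    simpa [hz] using cknAEss_nsZoom hϱ one_pos z.1 z.2 0 u
  have hEe : cknE 1 0 (ϱ ^ 2 • stPull (ϱ ^ 2) ϱ z.1 z.2 G) = cknE ϱ z G := by
    simpa [hz] using cknE_nsZoom hϱ one_pos z.1 z.2 0 G
  have hw : HasWeakSpatialGradientOn (parabolicCylinderOpens 1 0) (ϱ • stPull (ϱ ^ 2) ϱ z.1 z.2 u)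
      (ϱ ^ 2 • stPull (ϱ ^ 2) ϱ z.1 z.2 G) := by
    have := h.stRescale ϱ hϱ2 hϱ z.1 z.2
    rwa [stPreimage_parabolicCylinderOpens_self hϱ, ← sq] at this
  have key := hC₆ _ _ κ hκ hκ1 hw (by rwa [hAe]) (by rwa [hEe])
  rw [hC, hAe, hEe] at key
  have hinv : (ENNReal.ofReal κ)⁻¹ = ENNReal.ofReal (ϱ / r) := by
    rw [← ENNReal.ofReal_inv_of_pos hκ, hκdef, inv_div]
  rwa [hinv] at key


end Seregin2020

end Literature.Analysis.FluidPDE
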